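import Summits.QuantumFields.YangMills.Theorems.AlphaInputsT3ACv3TransfiniteFillBox
import Summits.QuantumFields.YangMills.Theorems.AlphaInputsT3ACv3ModelBoxExpCurl
import HarnessLib

/-!
# `AlphaInputsT3ACv3TransfiniteFillExp` — row (S4) of the 19936 (FL) START v3, LAST LETTER: **THE EXPONENTIAL START FIELD OF THE FILL** on ★w1-19936 g2 LEAD's model box —
# `fillSU R A hA u μ := ⟨fillB R A u μ, _⟩ ∈ 𝔰𝔲(n)` for `𝔰𝔲(n)`-valued boundary data, EQUAL TO THE DATUM on boundary bonds (so `expSU ∘ fillSU` glues to the outside field bond by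
# bond), and ★★ `dist1 (plaqB (expSU ∘ fillSU) u μ ν) ≤ b + 4a∕R + 144a²` on every box plaquette from `‖A‖ ≤ a` on boundary bonds (`12a ≤ 1`) and `‖curlB A‖ ≤ b` on boundary
# plaquettes = memo §3 (B)'s «plaquettes `≤ C(b + a∕R) + O(a²)` inside Q» with the constants `(1, 4, 144)` — cell `ym3-torus`, width seat `ym-ust-19936-w3` (g0)

WHY.  (S4) (`…TransfiniteFill`, `…TransfiniteFillBox`) gives the interpolated logarithm `fillB R A` with `‖fillB‖ ≤ 3a`, `‖curlB fillB‖ ≤ b + 4a∕R`, exact on the boundary;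
`…ModelBoxExpCurl` gives `dist1 (plaqB (expSU ∘ X)) ≤ ‖curlB X‖ + 16δ²` for `‖X‖ ≤ δ`, `4δ ≤ 1`.  THIS FILE composes them (δ = 3a): `fillSU` (one small def: the fill as an
`𝔰𝔲(n)`-valued model form), `coe_fillSU`, ★ `fillSU_eq_of_bdryBond` ∕ `expSU_fillSU_eq_of_bdryBond` (boundary agreement, bond by bond), `norm_fillSU_le` (`≤ 3a` on box bonds),
★★ `dist1_plaqB_expSU_fillSU_le` (`≤ b + 4a∕R + 144a²` on box plaquettes), and the def-free generic form ★★ `dist1_plaqB_expSU_of_coe_fillB_le` for ANY `𝔰𝔲`-valued `X` reading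
`fillB R A` on box bonds; gauge-covariant readings via LEAD's `dist1_plaqB_gaugeB`.
HONEST FRAMING.  Bookkeeping; nothing of [Balaban1985UV3]∕[Balaban1985Variational]∕[Balaban1985Averaging] is asserted; the START's remaining rows ((S2) tubes, (S3) boundary gauge,
(S5) chart∕assembly, (S6) defect), (FL)∕`hLift`, the stub 2′χ, the crux `HistoryTailL` and any gap are NOT claimed; count-neutral helper (`--supports stmt-QuantumFields-19936`);
registry untouched.  YM₃ on the three-torus is a RUNG of the programme, not the Clay problem; nothing here is about d = 4, infinite volume or a mass gap.

References: T. Bałaban, Commun. Math. Phys. 102 (1985) 277–309 [Balaban1985Variational] ((8), (11)–(13) pp.279–280); W. Rossmann, Lie Groups (OUP 2002) §1.3 [Rossmann2002].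
-/

set_option autoImplicit false

noncomputable section

open scoped Matrix.Norms.L2Operator

namespace Summit.QuantumFields.YangMills.Theorems.TransfiniteFill

open Literature.MathematicalPhysics.QuantumFieldTheory.Balaban1983to89
open Literature.MathematicalPhysics.QuantumFieldTheory.Balaban1983to89.T4AdjointCovarianceUnitary (lieSU expSU coe_expSU)
open ModelBox (e curlB curlB_def plaqB gaugeB coe_curlB_lieSU dist1_plaqB_expSU_le dist1_plaqB_gaugeB)

variable {n : Type*} [Fintype n] [DecidableEq n]

/-! ## §1 The generic composite (def-free) -/

/-- **★★ PLAQUETTES OF THE EXPONENTIAL START FIELD, generic form**: for ANY `𝔰𝔲(n)`-valued model form `X` which reads `fillB R A` on the box bonds, boundary data with `‖A‖ ≤ a` on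
boundary bonds (`12a ≤ 1`) and `‖curlB A‖ ≤ b` on boundary plaquettes, every box plaquette (`μ ≠ ν`) of `expSU ∘ X` has `dist1 ≤ b + 4a∕R + 144a²`.
[cite: Balaban1985Variational, (8)+(11)–(13) pp.279–280] -/
theorem dist1_plaqB_expSU_of_coe_fillB_le [Nonempty n] {R : ℕ} (hR : R ≠ 0) (A : (Fin 3 → ℤ) → Fin 3 → Matrix n n ℂ) {a b : ℝ} (ha : 0 ≤ a) (h12 : 12 * a ≤ 1)
    (hA : ∀ v ν, ModelBox.BdryBond R v ν → ‖A v ν‖ ≤ a) (hB : ∀ v μ ν, ModelBox.BdryPlaq R v μ ν → ‖curlB A v μ ν‖ ≤ b)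
    (X : (Fin 3 → ℤ) → Fin 3 → lieSU n) (hX : ∀ v κ, ModelBox.BondInBox R v κ → ((X v κ : lieSU n) : Matrix n n ℂ) = fillB R A v κ)
    {u : Fin 3 → ℤ} {μ ν : Fin 3} (hμν : μ ≠ ν) (hu : ModelBox.PlaqInBox R u μ ν) :
    GaugeGroup.dist1 (plaqB (fun v κ => expSU (X v κ)) u μ ν) ≤ b + 4 * a / R + 144 * a ^ 2 := by
  obtain ⟨h1, h2, h3, h4⟩ := hu.bondInBox
  have hδ : 4 * (3 * a) ≤ 1 := by linarith
  have nb : ∀ {v : Fin 3 → ℤ} {κ : Fin 3}, ModelBox.BondInBox R v κ → ‖((X v κ : lieSU n) : Matrix n n ℂ)‖ ≤ 3 * a := fun hv => by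
    rw [hX _ _ hv]; exact norm_fillB_le hR A ha hA hv
  have hc : ‖((curlB X u μ ν : lieSU n) : Matrix n n ℂ)‖ ≤ b + 4 * a / R := by
    rw [coe_curlB_lieSU, hX _ _ h1, hX _ _ h2, hX _ _ h3, hX _ _ h4, ← curlB_def]
    exact norm_curlB_fillB_le hR A ha hA hB hμν hu
  have h := dist1_plaqB_expSU_le X u μ ν hδ (nb h1) (nb h2) (nb h3) (nb h4)
  calc _ ≤ (b + 4 * a / R) + 16 * (3 * a) ^ 2 := by linarith
    _ = b + 4 * a / R + 144 * a ^ 2 := by ring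

/-- The same for the gauged field `(expSU ∘ X)^g` (any model gauge `g`). [cite: Balaban1985Averaging, (12) p.19] -/
theorem dist1_plaqB_gaugeB_expSU_of_coe_fillB_le [Nonempty n] {R : ℕ} (hR : R ≠ 0) (A : (Fin 3 → ℤ) → Fin 3 → Matrix n n ℂ) {a b : ℝ} (ha : 0 ≤ a) (h12 : 12 * a ≤ 1)
    (hA : ∀ v ν, ModelBox.BdryBond R v ν → ‖A v ν‖ ≤ a) (hB : ∀ v μ ν, ModelBox.BdryPlaq R v μ ν → ‖curlB A v μ ν‖ ≤ b)
    (X : (Fin 3 → ℤ) → Fin 3 → lieSU n) (hX : ∀ v κ, ModelBox.BondInBox R v κ → ((X v κ : lieSU n) : Matrix n n ℂ) = fillB R A v κ)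
    (g : (Fin 3 → ℤ) → Matrix.specialUnitaryGroup n ℂ) {u : Fin 3 → ℤ} {μ ν : Fin 3} (hμν : μ ≠ ν) (hu : ModelBox.PlaqInBox R u μ ν) :
    GaugeGroup.dist1 (plaqB (gaugeB g (fun v κ => expSU (X v κ))) u μ ν) ≤ b + 4 * a / R + 144 * a ^ 2 := by
  rw [dist1_plaqB_gaugeB]
  exact dist1_plaqB_expSU_of_coe_fillB_le hR A ha h12 hA hB X hX hμν hu

/-! ## §2 The fill as an `𝔰𝔲(n)`-valued model form -/

/-- **THE FILL AS AN `𝔰𝔲(n)`-VALUED MODEL FORM**: for data with values in `𝔰𝔲(n) ⊂ M_n(ℂ)` the fill is `𝔰𝔲(n)`-valued (`fillB_mem`); packaged as a map into `lieSU n`.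
[cite: Balaban1985Variational, (8) p.279] -/
def fillSU (R : ℕ) (A : (Fin 3 → ℤ) → Fin 3 → Matrix n n ℂ) (hA : ∀ v ν, A v ν ∈ lieSU n) (u : Fin 3 → ℤ) (μ : Fin 3) : lieSU n :=
  ⟨fillB R A u μ, fillB_mem R (lieSU n) hA u μ⟩

omit [DecidableEq n] in
/-- Its matrix is the fill. [folklore] -/
@[simp] theorem coe_fillSU (R : ℕ) (A : (Fin 3 → ℤ) → Fin 3 → Matrix n n ℂ) (hA : ∀ v ν, A v ν ∈ lieSU n) (u : Fin 3 → ℤ) (μ : Fin 3) :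
    ((fillSU R A hA u μ : lieSU n) : Matrix n n ℂ) = fillB R A u μ := rfl

omit [DecidableEq n] in
/-- **★ BOUNDARY AGREEMENT**: on LEAD's boundary bonds the `𝔰𝔲`-valued fill IS the datum. [folklore] -/
theorem fillSU_eq_of_bdryBond {R : ℕ} (hR : R ≠ 0) (A : (Fin 3 → ℤ) → Fin 3 → Matrix n n ℂ) (hA : ∀ v ν, A v ν ∈ lieSU n) {u : Fin 3 → ℤ} {μ : Fin 3}
    (h : ModelBox.BdryBond R u μ) : fillSU R A hA u μ = ⟨A u μ, hA u μ⟩ :=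
  Subtype.ext (fillB_eq_of_bdryBond hR A h)

/-- **BOUNDARY AGREEMENT OF THE EXPONENTIAL FIELDS**: `expSU (fillSU u μ) = expSU (A u μ)` on boundary bonds — the START field glues to the outside field bond by bond.
[cite: Balaban1985Variational, (11)–(13) pp.279–280] -/
theorem expSU_fillSU_eq_of_bdryBond {R : ℕ} (hR : R ≠ 0) (A : (Fin 3 → ℤ) → Fin 3 → Matrix n n ℂ) (hA : ∀ v ν, A v ν ∈ lieSU n) {u : Fin 3 → ℤ} {μ : Fin 3}
    (h : ModelBox.BdryBond R u μ) : expSU (fillSU R A hA u μ) = expSU ⟨A u μ, hA u μ⟩ := by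
  rw [fillSU_eq_of_bdryBond hR A hA h]

/-- The sup bound `≤ 3a` on box bonds, `𝔰𝔲` packaging. [folklore] -/
theorem norm_fillSU_le {R : ℕ} (hR : R ≠ 0) (A : (Fin 3 → ℤ) → Fin 3 → Matrix n n ℂ) (hA : ∀ v ν, A v ν ∈ lieSU n) {a : ℝ} (ha : 0 ≤ a)
    (hAa : ∀ v ν, ModelBox.BdryBond R v ν → ‖A v ν‖ ≤ a) {u : Fin 3 → ℤ} {μ : Fin 3} (hu : ModelBox.BondInBox R u μ) :
    ‖((fillSU R A hA u μ : lieSU n) : Matrix n n ℂ)‖ ≤ 3 * a := by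
  rw [coe_fillSU]; exact norm_fillB_le hR A ha hAa hu

/-- **★★ PLAQUETTES OF THE EXPONENTIAL START FIELD OF THE FILL**: `dist1 (plaqB (expSU ∘ fillSU R A hA) u μ ν) ≤ b + 4a∕R + 144a²` on every box plaquette (`μ ≠ ν`) from
`‖A‖ ≤ a` on boundary bonds (`12a ≤ 1`) and `‖curlB A‖ ≤ b` on boundary plaquettes. [cite: Balaban1985Variational, (8)+(11)–(13) pp.279–280] -/
theorem dist1_plaqB_expSU_fillSU_le [Nonempty n] {R : ℕ} (hR : R ≠ 0) (A : (Fin 3 → ℤ) → Fin 3 → Matrix n n ℂ) (hA : ∀ v ν, A v ν ∈ lieSU n) {a b : ℝ} (ha : 0 ≤ a)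
    (h12 : 12 * a ≤ 1) (hAa : ∀ v ν, ModelBox.BdryBond R v ν → ‖A v ν‖ ≤ a) (hB : ∀ v μ ν, ModelBox.BdryPlaq R v μ ν → ‖curlB A v μ ν‖ ≤ b)
    {u : Fin 3 → ℤ} {μ ν : Fin 3} (hμν : μ ≠ ν) (hu : ModelBox.PlaqInBox R u μ ν) :
    GaugeGroup.dist1 (plaqB (fun v κ => expSU (fillSU R A hA v κ)) u μ ν) ≤ b + 4 * a / R + 144 * a ^ 2 :=
  dist1_plaqB_expSU_of_coe_fillB_le hR A ha h12 hAa hB (fillSU R A hA) (fun _ _ _ => rfl) hμν hu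

/-- The same for the gauged START field `(expSU ∘ fillSU)^g`. [cite: Balaban1985Averaging, (12) p.19] -/
theorem dist1_plaqB_gaugeB_expSU_fillSU_le [Nonempty n] {R : ℕ} (hR : R ≠ 0) (A : (Fin 3 → ℤ) → Fin 3 → Matrix n n ℂ) (hA : ∀ v ν, A v ν ∈ lieSU n) {a b : ℝ}
    (ha : 0 ≤ a) (h12 : 12 * a ≤ 1) (hAa : ∀ v ν, ModelBox.BdryBond R v ν → ‖A v ν‖ ≤ a) (hB : ∀ v μ ν, ModelBox.BdryPlaq R v μ ν → ‖curlB A v μ ν‖ ≤ b)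
    (g : (Fin 3 → ℤ) → Matrix.specialUnitaryGroup n ℂ) {u : Fin 3 → ℤ} {μ ν : Fin 3} (hμν : μ ≠ ν) (hu : ModelBox.PlaqInBox R u μ ν) :
    GaugeGroup.dist1 (plaqB (gaugeB g (fun v κ => expSU (fillSU R A hA v κ))) u μ ν) ≤ b + 4 * a / R + 144 * a ^ 2 := by
  rw [dist1_plaqB_gaugeB]
  exact dist1_plaqB_expSU_fillSU_le hR A hA ha h12 hAa hB hμν hu

end Summit.QuantumFields.YangMills.Theorems.TransfiniteFill

end
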